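import Summits.BirchSwinnertonDyer.BirchSwinnertonDyer.Theorems.SemiOrdinaryEisensteinDescentWildSplitEisensteinValueAtOneVVisible298134c1Partner
import Summits.BirchSwinnertonDyer.Rank1Residual.GaloisImage.CongruenceVisibilityIdentityComponentRat
import Summits.BirchSwinnertonDyer.Rank1Residual.GaloisImage.VisibleWitnessHybridPlaces
import HarnessLib

/-!
# Route `SemiOrdinaryEisensteinDescent`, crux #2″ `WildSplitEisensteinValueAtOneV` (E_𝟙^V, stmt-BirchSwinnertonDyer-26610):
# the ℚ-level content row `298134c1` — the LOWER HALF `ord₃ #Ш_an ≤ ord₃ #Ш` at `3` from a VISIBLE element of `Ш[3]`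
# (the 3-congruent RANK-3 partner `99378d1`), with the partner's rank, the bad places and all local kinds decided IN THE KERNEL
# (cell `pub/bsd-wall`, width seat `bsd-wall-soed-p1-w3` g20; `--supports stmt-BirchSwinnertonDyer-26610`; THEOREMS ONLY; Theses-FREE)

WHY. Fifth kernel record of the seat's VISIBLE-NINE instrument for crux #2″ (memo
`Cruxes/WildSplitEisensteinInclusionAtThree/E1V-VISIBLE-NINE-w3g20.md`; records `…Visible371682b1.lean`, `…Visible441099r1.lean`, `…Visible298134c1.lean`; row
`352944s1` = cell `b2b-bsdres`'s `Rank1Residual/Visibility/TwoWitnessLowerHalf352944s1.lean`). Here `E = 298134c1 = [1, −1, 0, −4014, −386348]`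
(`N = 2·3³·5521`, `Δ = −2¹³·3⁵·5521²`, `r_an = 1`, `#Ш_an = 9`, `E(ℚ)_tors = 1`), `F = 99378d1 = [1, −1, 0, −153, 841]` (`N′ = N/3`,
`Δ′ = −2²·3⁷·5521`, rank `3`; `a_ℓ(E) ≡ a_ℓ(F) (mod 3)` at all 76 tested primes — the datum `θ`).

THE CERTIFICATE (door `VisibleLowerHalf.missingLowerBoundAt_of_congr_of_places_of_analyticRank_one`, `p = 3`): `S = {v₂, v₃, v₅₅₂₁}`;
`v₃` PAID with `#F(ℚ₃)[3] = 1` (`F` additive at `3`; decider `LocalTorsion3.threeTorsionCheck`, one Hensel ball), `#(ℤ₃/3) = 3`, so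
`3·3 < 27 ≤ 3^{rank F}`; `v₂`: kind (iii) — both multiplicative, `γ(E)/γ(F)` a `2`-adic unit square, `μ₃(ℚ₂) = 1`; `v₅₅₂₁`: kind (ii) — BOTH
SPLIT multiplicative (node-tangent root certificates `t = 2691`, `t′ = 2460` modulo `5521`, tree
`DivisionDecider.hasSplitMultiplicativeReductionAt_of_intModel_of_root`) and `#E(ℚ₅₅₂₁)[3] ≤ 3` (decider `threeTorsionCheckAt 5521`, one ball with
square `g`: `μ₃ ⊂ ℚ₅₅₂₁`). DECIDED HERE also: `gcd(#E(ℚ)_tors, 3) = 1` (`#Ẽ(𝔽₅) = 5`), `E` and `F` globally minimal (Kraus), good reduction outside `S`. WHAT STAYS DATA: `r_an(E) = 1`, `#Ш(E)_an = q` with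
`ord₃ q ≤ 2` (attested `9`), `θ : F[3] ⥲ E[3]` (to be Sturm-certified). Published binders: `hCT`, `hGZK`, `hU`, `hU2`.

HONEST FRAMING: CONDITIONAL on the displayed published facts and data; ONE curve; BSD₃ at `298134c1` NOT claimed; crux #2″ NOT advanced
class-wide; nothing booked. BSD is not proved by any of this.

References: [CremonaMazur2000] §3; [AgasheStein2002] Thm. 3.1; [SilvermanAEC2009] VII.1 Prop. 1.3(b), VII.2.1, VII.3.1, VII.5.1, VIII.6.7,
X.4.14; [SilvermanATAEC1994] V.3.1, V.5.3–5.4; [Serre1973] II.3.3; [Kraus1989]; [Knapp1993] V Thm. 5.1(c); [Miller2011LMS] Def. 1.1; Cremona's `ecdata`.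
-/

-- the Theorems namespace of this sub repeats the summit name by design (D-0017 nested layout)
set_option linter.dupNamespace false
set_option autoImplicit false

noncomputable section

open scoped Classical

open WeierstrassCurve IsDedekindDomain NumberField Rat.HeightOneSpectrum
  Literature.NumberTheory.EllipticCurves Literature.NumberTheory.EllipticCurves.Rank1Residual
  Literature.NumberTheory.EllipticCurves.Rank1Residual.Typed
  Literature.NumberTheory.EllipticCurves.Rank1Residual.X11RankOneCertificates
  Summit.BirchSwinnertonDyer.BirchSwinnertonDyer.Rank1Residual.IntModel
  Summit.BirchSwinnertonDyer.Rank1Residual Summit.BirchSwinnertonDyer.Rank1Residual.X11b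
  Summit.BirchSwinnertonDyer.Rank1Residual.Supersingular
  Summit.BirchSwinnertonDyer.Rank1Residual.GaloisImage
  Summit.BirchSwinnertonDyer.Rank2

namespace Summit.BirchSwinnertonDyer.BirchSwinnertonDyer.Theorems

namespace Visible298134c1

open VisiblePlaces D1VisibleKernel

/-! ## §1 The curve `E = 298134c1 = [1, −1, 0, −4014, −386348]`: model, minimality, no rational `3`-torsion; minimality of `F` -/

/-- `Δ(E) = −60678063415296 = −2¹³·3⁵·5521²`. [folklore] -/
theorem E_Δ : (⟨1, -1, 0, -4014, -386348⟩ : WeierstrassCurve ℤ).Δ = -60678063415296 := by decide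

/-- `c₄(E) = 192681` (odd, prime to `5521`). [folklore] -/
theorem E_c₄ : (⟨1, -1, 0, -4014, -386348⟩ : WeierstrassCurve ℤ).c₄ = 192681 := by decide

/-- The rational model of `E` is the base change of the integer one. [folklore] -/
theorem E_map_eq : (⟨1, -1, 0, -4014, -386348⟩ : WeierstrassCurve ℤ).map (Int.castRingHom ℚ) = (⟨1, -1, 0, -4014, -386348⟩ : WeierstrassCurve ℚ) := by
  ext <;> simp [WeierstrassCurve.map]

/-- The same in `baseChange` form. [folklore] -/
theorem E_baseChange_eq : (⟨1, -1, 0, -4014, -386348⟩ : WeierstrassCurve ℤ).baseChange ℚ = (⟨1, -1, 0, -4014, -386348⟩ : WeierstrassCurve ℚ) :=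
  E_map_eq

/-- `E/ℚ` is an elliptic curve. [folklore] -/
theorem isElliptic_E : (⟨1, -1, 0, -4014, -386348⟩ : WeierstrassCurve ℚ).IsElliptic :=
  isElliptic_of_discOf_ne_zero 1 (-1) 0 (-4014) (-386348) (by decide +kernel)

/-- **The Cremona model of `E` is globally minimal**: `|Δ| = 2¹³·3⁵·5521²`; at `2` the exponent is `13 ≥ 12` but `2⁴ ∤ c₄` (`c₄` odd), elsewhere the exponents are `< 12` (Kraus; tree
`isGloballyMinimal_of_krausCriterion₃_factored`). [cite: SilvermanAEC2009, VII.1 Remark 1.1] [cite: Kraus1989, Prop. 1 and Prop. 2] -/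
theorem isGloballyMinimal_E : (⟨1, -1, 0, -4014, -386348⟩ : WeierstrassCurve ℚ).IsGloballyMinimal :=
  isGloballyMinimal_of_krausCriterion₃_factored 1 (-1) 0 (-4014) (-386348)
    [(2, 13), (3, 5), (5521, 2)] (by decide +kernel)
    (by intro qe hqe; simp only [List.mem_cons, List.not_mem_nil, or_false] at hqe
        rcases hqe with rfl | rfl | rfl <;> norm_num)
    (by intro qe hqe; simp only [List.mem_cons, List.not_mem_nil, or_false] at hqe
        rcases hqe with rfl | rfl | rfl
        · exact Or.inr (Or.inl (by decide +kernel))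
        · exact Or.inl (by decide +kernel)
        · exact Or.inl (by decide +kernel))

/-- **The Cremona model of `F` is globally minimal**: `|Δ′| = 2²·3⁷·5521`, every exponent `< 12` (needed for the split-multiplicative root
certificate at `5521`). [cite: SilvermanAEC2009, VII.1 Remark 1.1] [cite: Kraus1989, Prop. 1 and Prop. 2] -/
theorem isGloballyMinimal_F : (⟨1, -1, 0, -153, 841⟩ : WeierstrassCurve ℚ).IsGloballyMinimal :=
  isGloballyMinimal_of_krausCriterion₃_factored 1 (-1) 0 (-153) 841
    [(2, 2), (3, 7), (5521, 1)] (by decide +kernel)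
    (by intro qe hqe; simp only [List.mem_cons, List.not_mem_nil, or_false] at hqe
        rcases hqe with rfl | rfl | rfl <;> norm_num)
    (by intro qe hqe; simp only [List.mem_cons, List.not_mem_nil, or_false] at hqe
        rcases hqe with rfl | rfl | rfl <;> exact Or.inl (by decide +kernel))

/-- `#Ẽ(𝔽₅) = 5` (kernel-decided; prime to `3`). [folklore] -/
theorem card_E_5 : Nat.card (((⟨1, -1, 0, -4014, -386348⟩ : WeierstrassCurve ℤ).map (Int.castRingHom (ZMod 5))).toAffine.Point) = 5 := by
  rw [@WeierstrassCurve.natCard_point_eq_one_add_card (ZMod 5) (@ZMod.instField 5 ⟨by norm_num⟩) _ _ _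
    (by decide +kernel), @card_sol_eq_sum_euler (ZMod 5) (@ZMod.instField 5 ⟨by norm_num⟩) _ _
    (by rw [ZMod.ringChar_zmod_n]; decide), ZMod.card]
  decide +kernel

/-- **`gcd(#E(ℚ)_tors, 3) = 1`**: `#E(ℚ)_tors ∣ #Ẽ(𝔽₅) = 5` (Knapp V Thm. 5.1(c), integer model, `5 ∤ Δ`). [cite: Knapp1993, Ch. V §1 Thm. 5.1(c)] -/
theorem coprime_torsionOrder_E [(⟨1, -1, 0, -4014, -386348⟩ : WeierstrassCurve ℚ).IsElliptic] :
    ((⟨1, -1, 0, -4014, -386348⟩ : WeierstrassCurve ℚ).torsionOrder).Coprime 3 := by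
  haveI : Fact (Nat.Prime 5) := ⟨by norm_num⟩
  haveI : (⟨1, -1, 0, -4014, -386348⟩ : WeierstrassCurve ℚ).IsIntegral ℤ :=
    ⟨⟨(⟨1, -1, 0, -4014, -386348⟩ : WeierstrassCurve ℤ), E_baseChange_eq.symm⟩⟩
  have h := LutzNagellGeneral.torsionOrder_dvd_natCard_point_map_zmod 5 (⟨1, -1, 0, -4014, -386348⟩ : WeierstrassCurve ℚ)
    (⟨1, -1, 0, -4014, -386348⟩ : WeierstrassCurve ℤ) E_baseChange_eq (Or.inl (by norm_num)) (by rw [E_Δ]; norm_num)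
  rw [card_E_5] at h
  exact Nat.Coprime.coprime_dvd_left h (by norm_num)

/-! ## §2 The local kinds at `S = {v₂, v₃, v₅₅₂₁}` and good reduction outside `S` -/

/-- `Δ(F) ≠ 0` on the integer model. [folklore] -/
theorem F_Δ_ne_zero : (⟨1, -1, 0, -153, 841⟩ : WeierstrassCurve ℤ).Δ ≠ 0 := by rw [F_Δ]; decide

/-- `Δ(E) ≠ 0` on the integer model. [folklore] -/
theorem E_Δ_ne_zero : (⟨1, -1, 0, -4014, -386348⟩ : WeierstrassCurve ℤ).Δ ≠ 0 := by rw [E_Δ]; decide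

/-- **The PAID place `v₃`: `#F(ℚ₃)[3] = 1` IN THE KERNEL** (decider `LocalTorsion3.threeTorsionCheck`, precision `k = 2`, one Hensel ball
`(1327, 1, 4, 0)` with `g` a non-square: `F` is additive at `3`). [cite: SilvermanAEC2009, VII.3.1 and Ex. 3.7] -/
theorem natCard_ker_three_F_at_3 :
    Nat.card (nsmulAddMonoidHom 3 : (((⟨1, -1, 0, -153, 841⟩ : WeierstrassCurve ℚ)).baseChange
      (((primesEquiv (R := 𝓞 ℚ)).symm ⟨3, by norm_num⟩).adicCompletion ℚ)).toAffine.Point →+ _).ker = 1 :=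
  LocalTorsion3.natCard_ker_nsmul_three_adicCompletion_eq_one_of_check 1 (-1) 0 (-153) 841 F_Δ_ne_zero
    (k := 2) (cert := [((1327 : ℤ), 1, 4, 0)]) (by decide +kernel) _ (by norm_num) (primesEquiv_placeAbove 3 (by norm_num))

/-- `γ(E) = −c₄/c₆ = −21409/37185747` over `ℚ` (`c₄ = 192681`, `c₆ = 334671723`). [folklore] -/
theorem gamma_E : -(((⟨1, -1, 0, -4014, -386348⟩ : WeierstrassCurve ℚ)).c₄ / ((⟨1, -1, 0, -4014, -386348⟩ : WeierstrassCurve ℚ)).c₆) =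
    -((21409 : ℚ) / 37185747) := by
  norm_num [WeierstrassCurve.c₄, WeierstrassCurve.c₆, WeierstrassCurve.b₂, WeierstrassCurve.b₄, WeierstrassCurve.b₆]

/-- `γ(F) = −c₄/c₆ = 817/77061` over `ℚ` (`c₄ = 7353`, `c₆ = −693549`). [folklore] -/
theorem gamma_F : -(((⟨1, -1, 0, -153, 841⟩ : WeierstrassCurve ℚ)).c₄ / ((⟨1, -1, 0, -153, 841⟩ : WeierstrassCurve ℚ)).c₆) =
    (817 : ℚ) / 77061 := by
  norm_num [WeierstrassCurve.c₄, WeierstrassCurve.c₆, WeierstrassCurve.b₂, WeierstrassCurve.b₄, WeierstrassCurve.b₆]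

/-- **Kind (iii) at `v₂`, IN THE KERNEL**: both `E` and `F` are multiplicative at `v₂` (`2 ∣ Δ`, `2 ∤ c₄` on the integer models),
`γ(E)/γ(F) = −549932983/10126918433` is a `2`-adic unit square (`N·D ≡ 1 (mod 8)`, `sqFlagAt 2`), and `μ₃(ℚ₂) = 1` (`−3` is not a square in
`ℚ₂`). [cite: SilvermanATAEC1994, Ch. V Thm. 5.3, Cor. 5.4] [cite: Serre1973, Ch. II §3.3] -/
theorem kind_iii_E_F_at_2 [(⟨1, -1, 0, -4014, -386348⟩ : WeierstrassCurve ℚ).IsElliptic] [(⟨1, -1, 0, -153, 841⟩ : WeierstrassCurve ℚ).IsElliptic] :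
    ((⟨1, -1, 0, -4014, -386348⟩ : WeierstrassCurve ℚ)).HasMultiplicativeReductionAt ((primesEquiv (R := 𝓞 ℚ)).symm ⟨2, by norm_num⟩) ∧
    ((⟨1, -1, 0, -153, 841⟩ : WeierstrassCurve ℚ)).HasMultiplicativeReductionAt ((primesEquiv (R := 𝓞 ℚ)).symm ⟨2, by norm_num⟩) ∧
    (∃ r : ((primesEquiv (R := 𝓞 ℚ)).symm ⟨2, by norm_num⟩).adicCompletion ℚ,
      algebraMap ℚ _ (-(((⟨1, -1, 0, -4014, -386348⟩ : WeierstrassCurve ℚ)).c₄ / ((⟨1, -1, 0, -4014, -386348⟩ : WeierstrassCurve ℚ)).c₆)) =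
        r ^ 2 * algebraMap ℚ _ (-(((⟨1, -1, 0, -153, 841⟩ : WeierstrassCurve ℚ)).c₄ / ((⟨1, -1, 0, -153, 841⟩ : WeierstrassCurve ℚ)).c₆))) ∧
    (∀ ζ : ((primesEquiv (R := 𝓞 ℚ)).symm ⟨2, by norm_num⟩).adicCompletion ℚ, ζ ^ 3 = 1 → ζ = 1) := by
  haveI : Fact (Nat.Prime 2) := ⟨by norm_num⟩
  haveI : ((⟨1, -1, 0, -4014, -386348⟩ : WeierstrassCurve ℤ).baseChange ℚ).IsElliptic := by rw [E_baseChange_eq]; infer_instance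
  haveI : ((⟨1, -1, 0, -153, 841⟩ : WeierstrassCurve ℤ).baseChange ℚ).IsElliptic := by rw [F_baseChange_eq]; infer_instance
  refine ⟨?_, ?_, ?_, LocalTorsion3At.forall_pow_three_eq_one_adicCompletion_of_sqFlagAt _ (primesEquiv_placeAbove 2 (by norm_num))
    (w₃ := 0) (by norm_num) (by norm_num) (by decide +kernel)⟩
  · have h := hasMultiplicativeReductionAt_baseChange_int_of_dvd_of_not_dvd (⟨1, -1, 0, -4014, -386348⟩ : WeierstrassCurve ℤ)
      ((primesEquiv (R := 𝓞 ℚ)).symm ⟨2, by norm_num⟩) (by rw [natGenerator_placeAbove, E_Δ]; decide)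
      (by rw [natGenerator_placeAbove, E_c₄]; decide)
    rwa [E_baseChange_eq] at h
  · have h := hasMultiplicativeReductionAt_baseChange_int_of_dvd_of_not_dvd (⟨1, -1, 0, -153, 841⟩ : WeierstrassCurve ℤ)
      ((primesEquiv (R := 𝓞 ℚ)).symm ⟨2, by norm_num⟩) (by rw [natGenerator_placeAbove, F_Δ]; decide)
      (by rw [natGenerator_placeAbove, F_c₄]; decide)
    rwa [F_baseChange_eq] at h
  · rw [gamma_E, gamma_F]
    exact LocalTorsion3At.exists_eq_sq_mul_of_sqFlagAt _ (primesEquiv_placeAbove 2 (by norm_num)) (by norm_num)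
      (N := -549932983) (D := 10126918433) (by norm_num) (by norm_num)
      (w := 0) (by norm_num) (by decide +kernel) (by decide +kernel)

/-- **Kind (ii) at `v₅₅₂₁`, IN THE KERNEL**: `E` and `F` are both SPLIT multiplicative at `v₅₅₂₁` (`5521 ∣ Δ`, `5521 ∤ c₄`, and the
node-tangent quadratic `c₄t² + a₁c₄t − (54b₆ − 3b₂b₄ + a₂c₄)` has the root `t = 2691`, resp. `t′ = 2460`, modulo `5521`; tree
`DivisionDecider.hasSplitMultiplicativeReductionAt_of_intModel_of_root`), and `#E(ℚ₅₅₂₁)[3] ≤ 3` (decider `threeTorsionCheckAt 5521` returns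
`some 1`: `5521 ≡ 1 (mod 3)`, `μ₃ ⊂ ℚ₅₅₂₁`). [cite: SilvermanAEC2009, VII.5 Prop. 5.1(b) and VII.1 Prop. 1.3(b)] [cite: SilvermanATAEC1994, Ch. V Thm. 3.1, Thm. 5.3] -/
theorem kind_ii_E_F_at_5521 [(⟨1, -1, 0, -4014, -386348⟩ : WeierstrassCurve ℚ).IsElliptic] [(⟨1, -1, 0, -4014, -386348⟩ : WeierstrassCurve ℚ).IsGloballyMinimal]
    [(⟨1, -1, 0, -153, 841⟩ : WeierstrassCurve ℚ).IsElliptic] [(⟨1, -1, 0, -153, 841⟩ : WeierstrassCurve ℚ).IsGloballyMinimal] :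
    ((⟨1, -1, 0, -4014, -386348⟩ : WeierstrassCurve ℚ)).HasSplitMultiplicativeReductionAt ((primesEquiv (R := 𝓞 ℚ)).symm ⟨5521, by norm_num⟩) ∧
    ((⟨1, -1, 0, -153, 841⟩ : WeierstrassCurve ℚ)).HasSplitMultiplicativeReductionAt ((primesEquiv (R := 𝓞 ℚ)).symm ⟨5521, by norm_num⟩) ∧
    Nat.card (nsmulAddMonoidHom 3 : (((⟨1, -1, 0, -4014, -386348⟩ : WeierstrassCurve ℚ)).baseChange
      (((primesEquiv (R := 𝓞 ℚ)).symm ⟨5521, by norm_num⟩).adicCompletion ℚ)).toAffine.Point →+ _).ker ≤ 3 := by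
  have hIE : (⟨1, -1, 0, -4014, -386348⟩ : WeierstrassCurve ℚ).integralModelInt = ⟨1, -1, 0, -4014, -386348⟩ :=
    integralModelInt_eq_of_map_eq _ (by ext <;> simp [WeierstrassCurve.map])
  have hIF : (⟨1, -1, 0, -153, 841⟩ : WeierstrassCurve ℚ).integralModelInt = ⟨1, -1, 0, -153, 841⟩ :=
    integralModelInt_eq_of_map_eq _ (by ext <;> simp [WeierstrassCurve.map])
  refine ⟨?_, ?_, ?_⟩
  · exact DivisionDecider.hasSplitMultiplicativeReductionAt_of_intModel_of_root 5521 (hq := ⟨by norm_num⟩) _ hIE (primesEquiv_placeAbove 5521 (by norm_num))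
      (by rw [E_Δ]; decide) (by rw [E_c₄]; decide) (2691 : ZMod 5521) (by decide +kernel)
  · exact DivisionDecider.hasSplitMultiplicativeReductionAt_of_intModel_of_root 5521 (hq := ⟨by norm_num⟩) _ hIF (primesEquiv_placeAbove 5521 (by norm_num))
      (by rw [F_Δ]; decide) (by rw [F_c₄]; decide) (2460 : ZMod 5521) (by decide +kernel)
  · exact LocalTorsion3At.natCard_ker_nsmul_three_adicCompletion_le_three_of_checkAt 5521 (hp := ⟨by norm_num⟩) 1 (-1) 0 (-4014) (-386348) (by norm_num)
      E_Δ_ne_zero (k := 1) (cert := [((3759181 : ℤ), 0, 2, 0)]) (by decide +kernel) _ (by norm_num)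
      (primesEquiv_placeAbove 5521 (by norm_num))

/-- Outside `{v₂, v₃, v₅₅₂₁}` the prime below `v` is none of `2, 3, 5521`. [folklore] -/
theorem natGenerator_ne_of_not_mem_places {v : HeightOneSpectrum (𝓞 ℚ)} (hv : v ∉ ({(primesEquiv (R := 𝓞 ℚ)).symm ⟨2, by norm_num⟩,
        (primesEquiv (R := 𝓞 ℚ)).symm ⟨3, by norm_num⟩, (primesEquiv (R := 𝓞 ℚ)).symm ⟨5521, by norm_num⟩} : Finset (HeightOneSpectrum (𝓞 ℚ)))) :
    natGenerator v ≠ 2 ∧ natGenerator v ≠ 3 ∧ natGenerator v ≠ 5521 := by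
  simp only [Finset.mem_insert, Finset.mem_singleton, not_or] at hv
  obtain ⟨h2, h3, h5521⟩ := hv
  exact ⟨fun h ↦ h2 (eq_placeAbove_of_natGenerator_eq (by norm_num) h),
    fun h ↦ h3 (eq_placeAbove_of_natGenerator_eq (by norm_num) h),
    fun h ↦ h5521 (eq_placeAbove_of_natGenerator_eq (by norm_num) h)⟩

/-- **Outside `{v₂, v₃, v₅₅₂₁}` both `E` and `F` have good reduction and `v ∤ 3`**: `Δ(E) = −2¹³·3⁵·5521²` and `Δ(F) = −2²·3⁷·5521` have no
prime factor outside `{2, 3, 5521}`. [cite: SilvermanAEC2009, VII.5 Prop. 5.1(a)] -/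
theorem good_outside_places (v : HeightOneSpectrum (𝓞 ℚ)) (hv : v ∉ ({(primesEquiv (R := 𝓞 ℚ)).symm ⟨2, by norm_num⟩,
        (primesEquiv (R := 𝓞 ℚ)).symm ⟨3, by norm_num⟩, (primesEquiv (R := 𝓞 ℚ)).symm ⟨5521, by norm_num⟩} : Finset (HeightOneSpectrum (𝓞 ℚ)))) :
    ((⟨1, -1, 0, -4014, -386348⟩ : WeierstrassCurve ℚ)).HasGoodReductionAt v ∧
    ((⟨1, -1, 0, -153, 841⟩ : WeierstrassCurve ℚ)).HasGoodReductionAt v ∧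
    ((3 : ℕ) : 𝓞 ℚ) ∉ v.asIdeal := by
  obtain ⟨h2, h3, h5521⟩ := natGenerator_ne_of_not_mem_places hv
  have hp : (natGenerator v).Prime := prime_natGenerator v
  have key : ∀ n : ℕ, n ∣ 2 ^ 13 * 3 ^ 7 * 5521 ^ 2 → n.Prime → n = 2 ∨ n = 3 ∨ n = 5521 := by
    intro n hn hn'
    rcases (Nat.Prime.dvd_mul hn').mp hn with h | h
    · rcases (Nat.Prime.dvd_mul hn').mp h with h | h
      · exact Or.inl ((Nat.prime_dvd_prime_iff_eq hn' (by norm_num)).mp (hn'.dvd_of_dvd_pow h))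
      · exact Or.inr (Or.inl ((Nat.prime_dvd_prime_iff_eq hn' (by norm_num)).mp (hn'.dvd_of_dvd_pow h)))
    · exact Or.inr (Or.inr ((Nat.prime_dvd_prime_iff_eq hn' (by norm_num)).mp (hn'.dvd_of_dvd_pow h)))
  have hnot : ¬ (natGenerator v ∣ 2 ^ 13 * 3 ^ 7 * 5521 ^ 2) := by
    intro h
    rcases key _ h hp with h | h | h
    · exact h2 h
    · exact h3 h
    · exact h5521 h
  refine ⟨?_, ?_, ?_⟩
  · have h := hasGoodReductionAt_baseChange_int_of_not_dvd (⟨1, -1, 0, -4014, -386348⟩ : WeierstrassCurve ℤ) v (by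
      rw [E_Δ]
      intro h
      apply hnot
      have h' : (natGenerator v : ℤ) ∣ ((2 ^ 13 * 3 ^ 7 * 5521 ^ 2 : ℕ) : ℤ) := (Int.dvd_neg.mpr h).trans (by norm_num)
      exact_mod_cast h')
    rwa [E_baseChange_eq] at h
  · have h := hasGoodReductionAt_baseChange_int_of_not_dvd (⟨1, -1, 0, -153, 841⟩ : WeierstrassCurve ℤ) v (by
      rw [F_Δ]
      intro h
      apply hnot
      have h' : (natGenerator v : ℤ) ∣ ((2 ^ 13 * 3 ^ 7 * 5521 ^ 2 : ℕ) : ℤ) := (Int.dvd_neg.mpr h).trans (by norm_num)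
      exact_mod_cast h')
    rwa [F_baseChange_eq] at h
  · rw [Nat.cast_ofNat, show (3 : 𝓞 ℚ) = ((3 : ℕ) : 𝓞 ℚ) by norm_num,
      natCast_mem_asIdeal_iff_eq_placeAbove v (by norm_num : (3 : ℕ).Prime)]
    intro h
    exact h3 (by rw [h, natGenerator_placeAbove])

end Visible298134c1

open Visible298134c1 VisiblePlaces D1VisibleKernel

/-! ## §3 The lower half at `(298134c1, 3)` from the visible element — rank, places, paid count and kinds in the kernel -/

/-- **`ord₃ #Ш(E)_an ≤ ord₃ #Ш(E)` for `E = 298134c1` from the `3`-congruent rank-`3` partner `F = 99378d1` — KERNEL form.**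
Published facts: Cassels–Tate (`hCT`), GZK (`hGZK`), Tate uniformisation (`hU`, `hU2`). DATA: `r_an(E) = 1` (`hr`), `#Ш(E)_an = q` with
`ord₃ q ≤ 2` (`hq`, `hv`; attested `q = 9`), and the `Γ_ℚ`-isomorphism `θ : F[3] ⥲ E[3]` (`θ`, `hθ`). DECIDED HERE: `3 ≤ rank F(ℚ)`
(companion file), the bad places `{v₂, v₃, v₅₅₂₁}` with good reduction outside, the paid count at `v₃` (`3·3 < 3³`), kind (iii) at `v₂`,
kind (ii) at `v₅₅₂₁` (both split multiplicative, `#E(ℚ₅₅₂₁)[3] ≤ 3`), `gcd(#E(ℚ)_tors, 3) = 1`. The instance binders are discharged by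
`isElliptic_E`, `isGloballyMinimal_E`, `Visible298134c1.isElliptic_F`, `isGloballyMinimal_F`. PER PAIR; CONDITIONAL; `MissingLowerBoundAt E 3` is the
ENTIRE ℚ-level content of crux #2″ at this curve modulo the leaf Z; BSD₃(E) is NOT claimed. [cite: CremonaMazur2000, §3 and Table 1]
[cite: AgasheStein2002, Thm. 3.1 and §3.5] [cite: SilvermanAEC2009, Thm. X.4.14] [cite: SilvermanATAEC1994, Ch. V Thm. 3.1, Thm. 5.3]
[cite: Miller2011LMS, Def. 1.1 (arXiv:1010.2431 p. 3)] -/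
theorem missingLowerBound_298134c1_of_visibleSha_kernel
    [(⟨1, -1, 0, -4014, -386348⟩ : WeierstrassCurve ℚ).IsElliptic] [(⟨1, -1, 0, -4014, -386348⟩ : WeierstrassCurve ℚ).IsGloballyMinimal]
    [(⟨1, -1, 0, -153, 841⟩ : WeierstrassCurve ℚ).IsElliptic] [(⟨1, -1, 0, -153, 841⟩ : WeierstrassCurve ℚ).IsGloballyMinimal]
    (hCT : exists_casselsTate_pairing (K := ℚ)) (hGZK : rank_eq_analyticRank_of_analyticRank_le_one)
    (hU : Silverman1994_thmV53_tateUniformisation.{0})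
    (hU2 : Silverman1994_thmV53_corV54_tateUniformisation.{0})
    (hr : (⟨1, -1, 0, -4014, -386348⟩ : WeierstrassCurve ℚ).analyticRank = 1)
    {q : ℚ} (hq : shaAn (⟨1, -1, 0, -4014, -386348⟩ : WeierstrassCurve ℚ) = (q : ℂ)) (hv : padicValRat 3 q ≤ 2)
    (θ : geomTorsion (⟨1, -1, 0, -153, 841⟩ : WeierstrassCurve ℚ) ((3 : ℕ) : ℤ) ≃+
      geomTorsion (⟨1, -1, 0, -4014, -386348⟩ : WeierstrassCurve ℚ) ((3 : ℕ) : ℤ))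
    (hθ : ∀ (σ : Field.absoluteGaloisGroup ℚ) (P : geomTorsion (⟨1, -1, 0, -153, 841⟩ : WeierstrassCurve ℚ) ((3 : ℕ) : ℤ)),
      θ (σ • P) = σ • θ P) :
    Typed.MissingLowerBoundAt (⟨1, -1, 0, -4014, -386348⟩ : WeierstrassCurve ℚ) 3 := by
  haveI : Fact (Nat.Prime 3) := ⟨Nat.prime_three⟩
  refine VisibleLowerHalf.missingLowerBoundAt_of_congr_of_places_of_analyticRank_one _ 3 hCT hGZK hU hU2 (by norm_num) hr
    coprime_torsionOrder_E hq hv _ θ hθ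
    ({(primesEquiv (R := 𝓞 ℚ)).symm ⟨2, by norm_num⟩, (primesEquiv (R := 𝓞 ℚ)).symm ⟨3, by norm_num⟩,
      (primesEquiv (R := 𝓞 ℚ)).symm ⟨5521, by norm_num⟩} : Finset (HeightOneSpectrum (𝓞 ℚ)))
    ({(primesEquiv (R := 𝓞 ℚ)).symm ⟨3, by norm_num⟩} : Finset (HeightOneSpectrum (𝓞 ℚ)))
    (Finset.singleton_subset_iff.mpr (by simp)) good_outside_places ?_ ?_
  · -- the paid count at `v₃`: `3 · (#F(ℚ₃)[3] · #(ℤ₃/3)) = 3 · (1 · 3) = 9 < 27 ≤ 3 ^ rank F`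
    rw [Finset.prod_singleton, natCard_ker_three_F_at_3, TwistedWitness.natCard_quot_three_of_primesEquiv_eq (primesEquiv_placeAbove 3 (by norm_num))]
    calc 3 * (1 * 3) = 3 ^ 2 := by norm_num
      _ < 3 ^ 3 := by norm_num
      _ ≤ 3 ^ (⟨1, -1, 0, -153, 841⟩ : WeierstrassCurve ℚ).mordellWeilRank := Nat.pow_le_pow_right (by norm_num) three_le_rank_F
  · intro v hvS hvT
    simp only [Finset.mem_insert, Finset.mem_singleton] at hvS
    rcases hvS with rfl | rfl | rfl
    · exact Or.inr (Or.inr kind_iii_E_F_at_2)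
    · exact absurd (Finset.mem_singleton_self _) hvT
    · exact Or.inr (Or.inl kind_ii_E_F_at_5521)

end Summit.BirchSwinnertonDyer.BirchSwinnertonDyer.Theorems

end
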